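import Summits.QuantumFields.BalabanUV.Beta.GAN24.MonotoneShorted
import Summits.QuantumFields.BalabanUV.Beta.GAN24.MonotoneTorusPlaquette
import Literature.MathematicalPhysics.QuantumFieldTheory.Balaban1983to89.B5Hk163Form166

/-!
# Beta / GAN24 / MonotoneTorusEffective — ROAD P4's HEADLINE READ ON THE PRINTED OBJECTS: the effective form of the level-`k` curl energy
# along Bałaban's average `Q_{Lc^k}` IS (twice) the printed `k`-step block action `Δ_k` of (1.65) (= the (1.66) form), and the plaquette
# covariance `plaqCov` of gen 3 IS the `Q_{Lc}`-constrained plaquette covariance of `Δ_k`; hence «the gauge-invariant content of the `k`-th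
# U = 1 fluctuation covariance is Loewner-antitone in `k`» and «`Δ_k` is Loewner-monotone in `k`» — both by Federbush + (1.17), no rate
# (gan24-p4 gen 4; BINDER-OWNERS row G-an2-4 ∕ (CONV-C), ALTERNATIVE DISCHARGE «rate OR monotonicity»; NOT IN PRINT — our proof attempt)

HONEST FRAMING (page 1 of everything the β sub-cell writes): discharging `BetaPertH` makes Bałaban's UV stability UNCONDITIONAL — a
real constructive-QFT result; it is NOT the continuum limit and NOT the Clay problem.  HONEST DEPENDENCY (cell reorg 2026-08-19, verbatim):
«continuum YM on T⁴ ⇐ BetaPertH ∧ nine spine estimates (0/9 proved); BetaPertH ⇐ (D1) ∧ (D4) ∧ CAP+tail; G-an2-4 gates asym, D1 and NE2/3/4.»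
HONEST LABEL: «not in print; our proof attempt; alternative discharge of the G-an2-4 row (rate OR monotonicity)»; 0 wall binders instantiated.
ABSOLUTE RULE honoured: NOTHING is cited here as a fact.  Every printed object enters as a TREE DEFINITION with its kernel theorems BY NAME:
`Beta.BlockEffectiveAction.DelK` ((1.65) `Δ_k := n^{-d}·H_kᴴ(½∂ᴴ∂)H_k`) with `curl_energy_min` («H_kB is a minimum of ½⟨∂A,∂A⟩ on {Q_kA = B}»)
and `curl_energy_Hk` (`½‖∂H_kB‖² = n^d·⟨B,Δ_kB⟩`); `Beta.FluctuationProjection.Jlift`∕`QvOp_mul_Jlift` (a section of `Q_k`) and `Hk` ((1.103));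
`B5Hk163Form166.DelK_form_eq_formDk` (the (1.65)↔(1.66) junction: `⟨B,Δ_kB⟩ = formDk`, kernel-certified there); `B5Action121.CurlOp`∕`form_CurlOp`,
`B5AverageCurlStokes.Fs_eq_mul_plaq`; gen 3's `MonotoneTorusTower`∕`MonotoneTorusPlaquette` and gen 4's `MonotoneShorted`.  [folklore] glue only.

## WHY (closing BOTH caveats of `HOME/b2b-balaban-gan24-p4/gen3/TORUS-AVATAR.md` § Reading)
Gen 3 proved `plaqCov_antitone_step` UNCONDITIONALLY but could only READ `plaqCov (QvOp Lc M₀) k` as «the plaquette covariance of the `k`-th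
fluctuation step» through an untyped dictionary with two caveats: (i) the two-stage variational identity for degenerate forms was not typed;
(ii) the variational form (1.65) was not identified with the printed (1.66).  (i) is gen 4's `MonotoneShorted.readOut_twoStage`; (ii) is the
tree's `B5Hk163Form166` (landed by the b05∕pv15 lineages).  THIS FILE assembles them on the torus tower.

## WHAT IS PROVED (every `d`, every `Lc ≥ 1`, every read-out torus `Tor M`, every level `k`, every `a > 0` — `Δ_k` is `a`-free by `DelK_indep`)
* §1 `sread_mul_Jlift` (the piecewise-constant lift is a section of the reading `sread k = Q_{Lc^k}`), **`effAction k := shortForm (hform k) (sread k) (Jlift)`**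
  — the effective (shorted) form of the level-`k` curl energy `(Lc²/Lc^d)^k Σ|plaq A|²` along `Q_{Lc^k}`; `effAction_quad` (its value at `B` =
  the minimal curl energy over the fibre `Q_{Lc^k} A = B`).
* §2 `sum_normSq_Fs_eq` (`Σ|F^η(A)|² = n²·Σ|plaq A|²`, `F^η = η⁻¹·plaq`), `curlOp_quad_eq`, `scal_eq` (`(Lc²/Lc^d)^k = n²/n^d`, `n = Lc^k`).
* §3 **`effAction_quad_eq_two_DelK : ⟨B, effAction k B⟩ = 2·⟨B, Δ_k B⟩`** (Bałaban's `H_kB` is a minimiser on the fibre — `curl_energy_min` — so it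
  computes the shorted form — `MonotoneShorted.shortForm_quad_eq_of_isMin` — and `curl_energy_Hk` evaluates it), hence
  **`effAction_eq_two_smul_DelK : effAction k = 2 • DelK (Lc^k)`** (polarisation, `B5Action121.ext_of_form_eq`) and
  **`effAction_quad_eq_two_formDk : ⟨B, effAction k B⟩ = 2·formDk (Lc^k) M B`** (the printed (1.66) form, via `DelK_form_eq_formDk`).
* §4 **`plaqCov_eq_critCov_DelK : plaqCov R k = curlMat M · critCov (2 • Δ_k) R · (curlMat M)ᴴ`** for EVERY constraint matrix `R` on the read-out
  1-forms — gen 3's plaquette covariance IS the plaquette covariance of the unit-lattice field `B` under the (degenerate, gauge-invariant) Gaussian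
  form `2Δ_k` constrained by `R B = 0` (canonical `critCov`, no gauge fixing; `R = QvOp Lc M₀` = the next averaging).  Inputs: `readOut_twoStage` +
  the null space of `effAction` is killed by `curlMat` (`curlMat_of_effAction_ker`, from gen 3's `curlMat_sread_mulVec_eq_zero`).
* §5 COROLLARIES ON THE PRINTED OBJECTS: **`critCov_DelK_plaq_antitone_step`** — `k ↦ curlMat·critCov (2Δ_k) R·curlMatᴴ` is LOEWNER-ANTITONE (every
  `k ≥ 0`, every `R`; = gen 3's `plaqCov_antitone_step` rewritten); **`DelK_step_mono : Δ_{Lc^k} ≤ Δ_{Lc^{k+1}}`** in the Loewner order on every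
  read-out torus — from Federbush's stability (`MonotoneTorusTower.stab_step`) + (1.17) (`sread_comp`) through `MonotoneShorted.shortForm_coarsen_le`;
  a SECOND MECHANISM for the monotonicity of Bałaban's `Δ_k` in the scale (asym1's `MonotoneScales.formDk_mono_of_dvd` proves it for the (1.66)
  form through the fibre symbols and King's composition law; here: variational, symbol-free, along powers of `Lc`).
WHAT THIS IS NOT: no rate, no constant, no datum VALUE; torus avatar, `U = 1`; NOT an2's `ℤ^{d+1}` wall system; 0 wall binders instantiated;
NOT (CONV-C), NOT BetaPertH, NOT continuum, NOT Clay.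
-/

noncomputable section

namespace Summit.QuantumFields.BalabanUV.Beta.GAN24.MonotoneTorusEffective

open Matrix Finset
open scoped BigOperators ComplexOrder
open Literature.MathematicalPhysics.QuantumFieldTheory.Balaban1983to89
open Literature.MathematicalPhysics.QuantumFieldTheory.Balaban1983to89.B5Prop11Plancherel (Tor fine)
open Literature.MathematicalPhysics.QuantumFieldTheory.Balaban1983to89.B5Block118 (QvOp)
open Literature.MathematicalPhysics.QuantumFieldTheory.Balaban1983to89.B5Action121 (CurlOp CurlOp_mulVec form_CurlOp ext_of_form_eq Fs)
open Literature.MathematicalPhysics.QuantumFieldTheory.Balaban1983to89.B5AverageCurlStokes (plaq Fs_eq_mul_plaq)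
open Literature.MathematicalPhysics.QuantumFieldTheory.Balaban1983to89.Beta.FluctuationProjection (Jlift QvOp_mul_Jlift Hk QvOp_Hk_mulVec)
open Literature.MathematicalPhysics.QuantumFieldTheory.Balaban1983to89.Beta.BlockEffectiveAction (DelK DelK_conjTranspose DelK_posSemidef
  curl_energy_min curl_energy_Hk)
open Literature.MathematicalPhysics.QuantumFieldTheory.Balaban1983to89.B5Hk163Form166 (DelK_form_eq_formDk)
open Literature.MathematicalPhysics.QuantumFieldTheory.Balaban1983to89.B5Bounds167Lattice (formDk)
open Summit.QuantumFields.BalabanUV.Beta.GAN24.MonotoneCoarsen (conj_pairing)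
open Summit.QuantumFields.BalabanUV.Beta.GAN24.MonotoneCritical (critCov critCov_isHermitian)
open Summit.QuantumFields.BalabanUV.Beta.GAN24.MonotoneShorted (harmExt shortForm shortForm_quad shortForm_isHermitian shortForm_posSemidef
  shortForm_quad_eq_of_isMin C_harmExt_mulVec harmExt_ker_of_shortForm_ker readOut_twoStage shortForm_coarsen_le)
open Summit.QuantumFields.BalabanUV.Beta.GAN24.MonotoneTorusTower (Lev sread cstep rows hform hform_isHermitian hform_posSemidef hform_quad scal
  scal_nonneg curlMat curlEnergy curlEnergy_nonneg stab_step sread_comp)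
open Summit.QuantumFields.BalabanUV.Beta.GAN24.MonotoneTorusPlaquette (plaqCov plaqCov_antitone_step curlMat_sread_mulVec_eq_zero)

variable {d : ℕ} (Lc : ℕ) [NeZero Lc] (M : Fin d → ℕ) [hM : ∀ μ, NeZero (M μ)]

/-! ## §1 The section of the reading and the effective action form of level `k` -/

omit [NeZero Lc] in
/-- `1 ≤ Lc^k` for `Lc ≥ 1` (the `hn` argument of the tree's `H_k`, `Δ_k`). [folklore] -/
theorem one_le_pow_Lc [NeZero Lc] (k : ℕ) : 1 ≤ Lc ^ k := Nat.one_le_pow k Lc (Nat.pos_of_ne_zero (NeZero.ne Lc))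

/-- **THE PIECEWISE-CONSTANT LIFT IS A SECTION OF THE READING**: `sread k * Jlift (Lc^k) M = 1` — the tree's `FluctuationProjection.QvOp_mul_Jlift`
BY NAME (`sread k = QvOp (Lc^k) M`). [folklore] -/
theorem sread_mul_Jlift (k : ℕ) : sread Lc M k * Jlift (Lc ^ k) M = 1 := QvOp_mul_Jlift (Lc ^ k) M

/-- **THE LEVEL-`k` EFFECTIVE ACTION FORM** on the read-out 1-forms: the shorted form (`MonotoneShorted.shortForm`) of the level-`k` curl energy
`hform k = (Lc²/Lc^d)^k • curlMatᴴ curlMat` along the reading `sread k = Q_{Lc^k}` — `⟨B, effAction k B⟩ = min {⟨A, hform k A⟩ : Q_{Lc^k} A = B}`. [folklore] -/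
def effAction (k : ℕ) : Matrix (Tor M × Fin d) (Tor M × Fin d) ℂ :=
  shortForm (hform_isHermitian Lc M k) (sread Lc M k) (Jlift (Lc ^ k) M)

/-- `effAction k` is Hermitian. [folklore] -/
theorem effAction_isHermitian (k : ℕ) : (effAction Lc M k).IsHermitian := shortForm_isHermitian _ _ _

/-- `effAction k` is positive semidefinite. [folklore] -/
theorem effAction_posSemidef (k : ℕ) : (effAction Lc M k).PosSemidef := shortForm_posSemidef (hform_posSemidef Lc M k) _ _

/-- The value of the effective action: `⟨B, effAction k B⟩ = (Lc²/Lc^d)^k · curlEnergy (harmExt B)` (the minimal curl energy over the fibre). [folklore] -/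
theorem effAction_quad (k : ℕ) (B : Tor M × Fin d → ℂ) :
    star B ⬝ᵥ (effAction Lc M k *ᵥ B)
      = ((scal (d := d) Lc k * curlEnergy (fine (Lc ^ k) M)
          (harmExt (hform_isHermitian Lc M k) (sread Lc M k) (Jlift (Lc ^ k) M) *ᵥ B) : ℝ) : ℂ) := by
  rw [effAction, shortForm_quad, hform_quad]

/-! ## §2 Unit bookkeeping: B5's `F^η = η⁻¹·plaq` and `(Lc²/Lc^d)^k = n²/n^d` -/

omit [NeZero Lc] in
/-- `Σ_{x,μ,ν} |F^η_{μν}(A)(x)|² = n² · curlEnergy A` (`F^η = n·plaq`, `B5AverageCurlStokes.Fs_eq_mul_plaq`). [folklore] -/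
theorem sum_normSq_Fs_eq (n : ℕ) [NeZero n] (A : Tor (fine n M) × Fin d → ℂ) :
    (∑ x, ∑ μ, ∑ ν, ‖Fs (fine n M) (n : ℂ) A μ ν x‖ ^ 2) = (n : ℝ) ^ 2 * curlEnergy (fine n M) A := by
  unfold curlEnergy
  simp_rw [Fs_eq_mul_plaq, norm_mul, Complex.norm_natCast, mul_pow, ← Finset.mul_sum]
  congr 1
  rw [Finset.sum_comm]
  exact Finset.sum_congr rfl fun μ _ => Finset.sum_comm

omit [NeZero Lc] in
/-- `‖∂A‖² = n² · curlEnergy A` for B5's curl operator `∂ = CurlOp (fine n M) n`. [folklore] -/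
theorem curlOp_quad_eq (n : ℕ) [NeZero n] (A : Tor (fine n M) × Fin d → ℂ) :
    star (CurlOp (fine n M) (n : ℂ) *ᵥ A) ⬝ᵥ (CurlOp (fine n M) (n : ℂ) *ᵥ A) = (((n : ℝ) ^ 2 * curlEnergy (fine n M) A : ℝ) : ℂ) := by
  rw [conj_pairing, mulVec_mulVec, form_CurlOp, sum_normSq_Fs_eq]

omit [NeZero Lc] in
/-- `(Lc²/Lc^d)^k = (Lc^k)²/(Lc^k)^d`. [folklore] -/
theorem scal_eq (k : ℕ) : scal (d := d) Lc k = ((Lc : ℝ) ^ k) ^ 2 / ((Lc : ℝ) ^ k) ^ d := by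
  unfold scal
  rw [div_pow, ← pow_mul, ← pow_mul, ← pow_mul, ← pow_mul, mul_comm 2 k, mul_comm d k]

/-! ## §3 THE IDENTIFICATION: `effAction k = 2 • Δ_k` (Bałaban's (1.65), tree def `DelK`) and `⟨B, effAction k B⟩ = 2·formDk` ((1.66)) -/

/-- **BAŁABAN'S `H_k B` COMPUTES THE EFFECTIVE ACTION**: `⟨B, effAction k B⟩ = (Lc²/Lc^d)^k · curlEnergy (H_k B)` — `H_k B` lies on the fibre
(`QvOp_Hk_mulVec`) and minimises the curl energy there (`curl_energy_min`), so `shortForm_quad_eq_of_isMin` applies. [folklore] -/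
theorem effAction_quad_eq_Hk (k : ℕ) (a : ℝ) (ha : 0 < a) (B : Tor M × Fin d → ℂ) :
    star B ⬝ᵥ (effAction Lc M k *ᵥ B)
      = ((scal (d := d) Lc k * curlEnergy (fine (Lc ^ k) M) (Hk (Lc ^ k) (one_le_pow_Lc Lc k) M a ha *ᵥ B) : ℝ) : ℂ) := by
  have hL : 0 < Lc := Nat.pos_of_ne_zero (NeZero.ne Lc)
  have hn2 : (0 : ℝ) < ((Lc ^ k : ℕ) : ℝ) ^ 2 := by positivity
  rw [effAction, ← hform_quad]
  refine shortForm_quad_eq_of_isMin (hform_posSemidef Lc M k) (sread_mul_Jlift Lc M k) (QvOp_Hk_mulVec _ _ _ _ _ B) fun A hA => ?_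
  rw [hform_quad, hform_quad]
  refine Complex.real_le_real.mpr (mul_le_mul_of_nonneg_left ?_ (scal_nonneg Lc k))
  -- `curl_energy_min` in B5's `F^η` currency, then divide by `n²`
  have hmin := curl_energy_min (Lc ^ k) (one_le_pow_Lc Lc k) M a ha A B hA
  rw [curlOp_quad_eq, curlOp_quad_eq, Complex.ofReal_re, Complex.ofReal_re] at hmin
  exact le_of_mul_le_mul_left hmin hn2

/-- **`⟨B, effAction k B⟩ = 2·⟨B, Δ_k B⟩`** — the value (1.65) `½‖∂H_kB‖²_η = n^d ⟨B, Δ_k B⟩` (`curl_energy_Hk`) in the units of `hform`. [folklore] -/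
theorem effAction_quad_eq_two_DelK (k : ℕ) (a : ℝ) (ha : 0 < a) (B : Tor M × Fin d → ℂ) :
    star B ⬝ᵥ (effAction Lc M k *ᵥ B) = 2 * (star B ⬝ᵥ (DelK (Lc ^ k) (one_le_pow_Lc Lc k) M a ha *ᵥ B)) := by
  -- `hval : (1/2) * ↑(n² · curlEnergy (H_kB)) = n^d · ⟨B, Δ_kB⟩`
  have hval := curl_energy_Hk (Lc ^ k) (one_le_pow_Lc Lc k) M a ha B
  rw [curlOp_quad_eq] at hval
  rw [effAction_quad_eq_Hk Lc M k a ha, scal_eq]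
  push_cast at hval ⊢
  have hNd : ((Lc : ℂ) ^ k) ^ d ≠ 0 := pow_ne_zero _ (pow_ne_zero _ (Nat.cast_ne_zero.mpr (NeZero.ne Lc)))
  rw [div_mul_eq_mul_div, div_eq_iff hNd]
  linear_combination 2 * hval

/-- **`effAction k = 2 • Δ_k`**: the shorted form of the level-`k` curl energy along `Q_{Lc^k}` IS twice Bałaban's printed `k`-step block action
(1.65) (tree def `Beta.BlockEffectiveAction.DelK`; the `2` is the ordered-pair count of `curlEnergy` against the `½` of (1.21)). [folklore] -/
theorem effAction_eq_two_smul_DelK (k : ℕ) (a : ℝ) (ha : 0 < a) :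
    effAction Lc M k = (2 : ℂ) • DelK (Lc ^ k) (one_le_pow_Lc Lc k) M a ha := by
  refine ext_of_form_eq fun B => ?_
  rw [effAction_quad_eq_two_DelK Lc M k a ha, smul_mulVec, dotProduct_smul, smul_eq_mul]

/-- **`⟨B, effAction k B⟩ = 2·formDk (Lc^k) M B`** — the minimal level-`k` curl energy over the fibre `Q_{Lc^k} A = B` is twice the PRINTED (1.66)
form `⟨B, Δ_kB⟩ = ½Σ_{μν}Σ_{p′} w166(p′)|(∂₁B)~_{μν}(p′)|²` (tree `B5Bounds167Lattice.formDk`; junction `B5Hk163Form166.DelK_form_eq_formDk` BY NAME). [folklore] -/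
theorem effAction_quad_eq_two_formDk (k : ℕ) (B : Tor M × Fin d → ℂ) :
    star B ⬝ᵥ (effAction Lc M k *ᵥ B) = (((2 * formDk (Lc ^ k) M B : ℝ)) : ℂ) := by
  rw [effAction_quad_eq_two_DelK Lc M k 1 one_pos, DelK_form_eq_formDk]
  push_cast
  ring

/-! ## §4 THE PLAQUETTE COVARIANCE IS THE CONSTRAINED PLAQUETTE COVARIANCE OF `2Δ_k` -/

/-- `2 • Δ_k` is Hermitian. [folklore] -/
theorem twoDelK_isHermitian (k : ℕ) (a : ℝ) (ha : 0 < a) : ((2 : ℂ) • DelK (Lc ^ k) (one_le_pow_Lc Lc k) M a ha).IsHermitian := by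
  rw [← effAction_eq_two_smul_DelK]
  exact effAction_isHermitian Lc M k

/-- `critCov` only depends on the matrix, not on the Hermitian-ness witness (rewriting under the proof argument). [folklore] -/
theorem critCov_congr {n m : Type*} [Fintype n] [DecidableEq n] [Fintype m] [DecidableEq m] {X Y : Matrix n n ℂ} (hX : X.IsHermitian)
    (hY : Y.IsHermitian) (h : X = Y) (Q : Matrix m n ℂ) : critCov hX Q = critCov hY Q := by
  subst h; rfl

/-- **THE NULL SPACE OF THE EFFECTIVE ACTION IS INVISIBLE TO THE PLAQUETTES**: `effAction k z = 0 ⟹ curlMat M z = 0` (a null `z` lifts to a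
curl-free fine field with average `z`, whose averages are curl-free — gen 3's `curlMat_sread_mulVec_eq_zero`). [folklore] -/
theorem curlMat_of_effAction_ker (k : ℕ) {z : Tor M × Fin d → ℂ} (hz : effAction Lc M k *ᵥ z = 0) : curlMat M *ᵥ z = 0 := by
  have h1 := harmExt_ker_of_shortForm_ker (hform_posSemidef Lc M k) (sread Lc M k) (Jlift (Lc ^ k) M) hz
  have h2 := curlMat_sread_mulVec_eq_zero Lc M k _ h1
  rwa [C_harmExt_mulVec (hform_isHermitian Lc M k) (sread_mul_Jlift Lc M k)] at h2

variable {c : Type*} [Fintype c] [DecidableEq c]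

/-- **`plaqCov R k = curlMat · critCov (effAction k) R · curlMatᴴ`** — the two-stage identity (`MonotoneShorted.readOut_twoStage`) on the torus
tower: constraining the level-`k` fine field by `R ∘ Q_{Lc^k}` and reading its plaquettes through `Q_{Lc^k}` = constraining the unit-lattice field
`B` by `R` under the effective action. [folklore] -/
theorem plaqCov_eq_critCov_effAction (R : Matrix c (Tor M × Fin d) ℂ) (k : ℕ) :
    plaqCov Lc M R k = curlMat M * critCov (effAction_isHermitian Lc M k) R * (curlMat M)ᴴ := by
  unfold plaqCov effAction
  exact readOut_twoStage (hform_posSemidef Lc M k) (sread_mul_Jlift Lc M k) R (curlMat M)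
    fun z _ hz => curlMat_of_effAction_ker Lc M k hz

/-- **`plaqCov R k = curlMat · critCov (2 • Δ_k) R · curlMatᴴ`**: gen 3's plaquette covariance at level `k` IS the plaquette covariance of the
unit-lattice field under (twice) BAŁABAN'S `k`-STEP BLOCK ACTION `Δ_k` (1.65), constrained by `R B = 0` (canonical constrained covariance, no gauge
fixing).  With `M = fine Lc M₀`, `R = QvOp Lc M₀` (the NEXT averaging, `MonotoneTorusTower.unitBlock_rows`) this is the gauge-invariant
(plaquette) content of the `k`-th U = 1 FLUCTUATION covariance. [folklore] -/
theorem plaqCov_eq_critCov_DelK (R : Matrix c (Tor M × Fin d) ℂ) (k : ℕ) (a : ℝ) (ha : 0 < a) :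
    plaqCov Lc M R k = curlMat M * critCov (twoDelK_isHermitian Lc M k a ha) R * (curlMat M)ᴴ := by
  rw [plaqCov_eq_critCov_effAction,
    critCov_congr (effAction_isHermitian Lc M k) (twoDelK_isHermitian Lc M k a ha) (effAction_eq_two_smul_DelK Lc M k a ha)]

/-! ## §5 Corollaries on the printed objects: the constrained plaquette covariance of `Δ_k` decreases, `Δ_k` increases -/

/-- **ROAD P4's (MONO-K) ON THE PRINTED OBJECTS**: for every read-out torus, every `Lc ≥ 1`, every constraint matrix `R` and every `k`,
`curlMat·critCov (2Δ_{Lc^{k+1}}) R·curlMatᴴ ≤ curlMat·critCov (2Δ_{Lc^k}) R·curlMatᴴ` in the Loewner order — the `R`-constrained plaquette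
covariance of Bałaban's block action DECREASES with the step (gen 3's `plaqCov_antitone_step`, rewritten by §4); with it come
`MonotoneTorusPlaquette.exists_plaqCov_limit` (the `k → ∞` limit exists) and `plaqCov_entry_dev_le` (one trace datum ⟹ entrywise band, NO rate). [folklore] -/
theorem critCov_DelK_plaq_antitone_step (R : Matrix c (Tor M × Fin d) ℂ) (k : ℕ) (a : ℝ) (ha : 0 < a) :
    (curlMat M * critCov (twoDelK_isHermitian Lc M k a ha) R * (curlMat M)ᴴ
      - curlMat M * critCov (twoDelK_isHermitian Lc M (k + 1) a ha) R * (curlMat M)ᴴ).PosSemidef := by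
  rw [← plaqCov_eq_critCov_DelK, ← plaqCov_eq_critCov_DelK]
  exact plaqCov_antitone_step Lc M R k

omit [DecidableEq c] [Fintype c] in
/-- **THE EFFECTIVE ACTIONS INCREASE WITH THE LEVEL**: `effAction k ≤ effAction (k+1)` — Federbush's stability (`stab_step`) + (1.17) (`sread_comp`)
through the degenerate (OSD) `MonotoneShorted.shortForm_coarsen_le`. [folklore] -/
theorem effAction_step_mono (k : ℕ) : (effAction Lc M (k + 1) - effAction Lc M k).PosSemidef := by
  have hSf : (sread Lc M k * cstep Lc M k) * Jlift (Lc ^ (k + 1)) M = 1 := by rw [sread_comp]; exact sread_mul_Jlift Lc M (k + 1)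
  have h := shortForm_coarsen_le (κ := Tor M × Fin d) (hform_posSemidef Lc M k) (hform_posSemidef Lc M (k + 1)) (stab_step Lc M k)
    (sread_mul_Jlift Lc M k) hSf
  rw [sread_comp] at h
  exact h

omit [DecidableEq c] [Fintype c] in
/-- **BAŁABAN'S `Δ_k` IS LOEWNER-MONOTONE IN THE SCALE**: `Δ_{Lc^k} ≤ Δ_{Lc^{k+1}}` on every read-out torus (tree def `DelK`, (1.65)), by the
variational mechanism (Federbush + (1.17)); cf. asym1's `MonotoneScales.formDk_mono_of_dvd` for the (1.66) form via the fibre symbols. [folklore] -/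
theorem DelK_step_mono (k : ℕ) (a : ℝ) (ha : 0 < a) :
    (DelK (Lc ^ (k + 1)) (one_le_pow_Lc Lc (k + 1)) M a ha - DelK (Lc ^ k) (one_le_pow_Lc Lc k) M a ha).PosSemidef := by
  have h := effAction_step_mono Lc M k
  rw [effAction_eq_two_smul_DelK Lc M (k + 1) a ha, effAction_eq_two_smul_DelK Lc M k a ha, ← smul_sub] at h
  have hH : (DelK (Lc ^ (k + 1)) (one_le_pow_Lc Lc (k + 1)) M a ha - DelK (Lc ^ k) (one_le_pow_Lc Lc k) M a ha).IsHermitian :=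
    (DelK_posSemidef _ _ _ _ _).isHermitian.sub (DelK_posSemidef _ _ _ _ _).isHermitian
  refine PosSemidef.of_dotProduct_mulVec_nonneg hH fun B => ?_
  have h2 := h.dotProduct_mulVec_nonneg B
  rw [smul_mulVec, dotProduct_smul, smul_eq_mul] at h2
  have hhalf : (0 : ℂ) ≤ (2 : ℂ)⁻¹ := by
    rw [show (2 : ℂ)⁻¹ = ((2⁻¹ : ℝ) : ℂ) by push_cast; rfl]
    exact Complex.zero_le_real.mpr (by norm_num)
  have e : star B ⬝ᵥ ((DelK (Lc ^ (k + 1)) (one_le_pow_Lc Lc (k + 1)) M a ha - DelK (Lc ^ k) (one_le_pow_Lc Lc k) M a ha) *ᵥ B)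
      = (2 : ℂ)⁻¹ * (2 * (star B ⬝ᵥ ((DelK (Lc ^ (k + 1)) (one_le_pow_Lc Lc (k + 1)) M a ha
          - DelK (Lc ^ k) (one_le_pow_Lc Lc k) M a ha) *ᵥ B))) := by
    rw [← mul_assoc, inv_mul_cancel₀ two_ne_zero, one_mul]
  rw [e]
  exact mul_nonneg hhalf h2

/-- The chain over several steps: `Δ_{Lc^k} ≤ Δ_{Lc^{k'}}` for `k ≤ k'`. [folklore] -/
theorem DelK_mono {k k' : ℕ} (h : k ≤ k') (a : ℝ) (ha : 0 < a) :
    (DelK (Lc ^ k') (one_le_pow_Lc Lc k') M a ha - DelK (Lc ^ k) (one_le_pow_Lc Lc k) M a ha).PosSemidef := by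
  induction h with
  | refl => rw [sub_self]; exact PosSemidef.zero
  | @step m _ ih =>
    show (DelK (Lc ^ (m + 1)) (one_le_pow_Lc Lc (m + 1)) M a ha - DelK (Lc ^ k) (one_le_pow_Lc Lc k) M a ha).PosSemidef
    have e := sub_add_sub_cancel (DelK (Lc ^ (m + 1)) (one_le_pow_Lc Lc (m + 1)) M a ha) (DelK (Lc ^ m) (one_le_pow_Lc Lc m) M a ha)
      (DelK (Lc ^ k) (one_le_pow_Lc Lc k) M a ha)
    rw [← e]
    exact (DelK_step_mono Lc M m a ha).add ih

end Summit.QuantumFields.BalabanUV.Beta.GAN24.MonotoneTorusEffective
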